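import Mathlib
import Summits.MatrixMultiplication.MatrixMultiplication.Theorems.SubgroupIdentityDesigns.Negative.ScalarLaw

/-!
# Level-one certificates in `GL_m(𝔽_p)`: coset, character and det-fixer criteria, every `m`

Route `LevelGradedCohnUmans`, crux `SubgroupIdentityDesigns` (stmt-MatrixMultiplication-14079),
cells `(m, k) = (m, 1)`.  VALUE = THEOREM (all `p`, all `m ≥ 1`: the engine layer for the
`(m,1)` cells, `m ≥ 3`, now that the `(2,1)` cell is empty, `CellTwoOneEmpty.lean`), NOT summit
progress; the crux item is untouched and remains open.

The single-subgroup exclusion engine of the `(2,1)` cell (`CosetCertificate.lean`, `Fixers.lean`,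
`LargePfreeMember.lean`) is stated there for `GL₂(𝔽_p)`; its proof is dimension-free.  A level-`1`
function `F(g) = Σ_{rk M ≤ 1} c_M ψ(tr(M g))` is a constant plus a sum of functions of ONE
matrix–vector product `g a` (`M = a bᵀ`, `tr(a bᵀ g) = b ⬝ (g a)`), so for `K ≤ GL_m(𝔽_p)` and
a weight `f` summing to zero over `K` and over every left coset `k · Stab_K(a)` (`a ≠ 0`),
`Σ_{k ∈ K} f(k) F(k) = 0` (`sum_weight_fourier_eq_zero_gl`); if `f(1) ≠ 0` and
`K ∖ 1 ⊆ H₁ H₂ H₃` (triple products), no level-one identity design exists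
(`no_levelOne_design_of_coset_certificate_gl`).  Corollaries (no TPP, no volume):
`no_levelOne_design_of_character_gl` (`χ` multiplicative on `K`, `χ 1 ≠ 0`, `Σ_{Stab_K(a)} χ = 0`
for all `a ≠ 0`); **`no_levelOne_design_of_detFixers_gl`** — every non-zero vector is fixed by
some `s ∈ K` with `det s ≠ 1` (for `m ≥ 3` a `p`-free non-trivial fixer may be unimodular,
`diag(1, t, t⁻¹)`, so `det s ≠ 1` is the hypothesis to certify); `exists_fixer_of_card_gt_gl`
(pigeonhole: `|K| > p^m - 1` ⇒ non-trivial fixers of every non-zero vector);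
`triple_of_le₁/₂/₃`, `triple_of_mul_scalar₁/₂/₃` (the product-set hypothesis from `K ≤ Hᵢ`,
resp. from `H ≤ Hᵢ` and a SCALAR COVER `S₁ S₂ S₃ = Z`, scalars being central).
-/

set_option linter.dupNamespace false

noncomputable section
open scoped BigOperators Classical
open Summit.MatrixMultiplication.MatrixMultiplication.Theorems.LieRankDesigns.Negative (GLm Mat)

namespace Summit.MatrixMultiplication.MatrixMultiplication.Theorems.SubgroupIdentityDesigns.Negative

section GLmLevelOneCertificates

variable {p : ℕ} [hp : Fact p.Prime] {m : ℕ}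

/-- A square matrix of rank `≤ 1` over `𝔽_p` is an outer product `a bᵀ` (any size). [folklore] -/
theorem exists_eq_vecMulVec_of_rank_le_one_gl (M : Mat p m) (hM : M.rank ≤ 1) :
    ∃ (a b : Fin m → ZMod p), M = Matrix.vecMulVec a b := by
  obtain ⟨v, hv⟩ := finrank_le_one_iff.1 hM
  have hcol : ∀ j, ∃ c : ZMod p, c • (v : Fin m → ZMod p) = M.col j := by
    intro j
    have hmem : M.col j ∈ LinearMap.range M.mulVecLin :=
      ⟨Pi.single j 1, by rw [Matrix.mulVecLin_apply, Matrix.mulVec_single_one]⟩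
    obtain ⟨c, hc⟩ := hv ⟨M.col j, hmem⟩
    exact ⟨c, by simpa using congrArg Subtype.val hc⟩
  choose c hc using hcol
  refine ⟨v, c, ?_⟩
  ext i j
  have h := congrFun (hc j) i
  simp only [Pi.smul_apply, smul_eq_mul, Matrix.col_apply] at h
  rw [Matrix.vecMulVec_apply, ← h, mul_comm]

/-- `tr(a bᵀ g) = b ⬝ (g a)`. [folklore] -/
theorem trace_vecMulVec_mul_gl (a b : Fin m → ZMod p) (g : Mat p m) :
    Matrix.trace (Matrix.vecMulVec a b * g) = b ⬝ᵥ (g.mulVec a) := by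
  rw [Matrix.vecMulVec_mul, Matrix.trace_vecMulVec, dotProduct_comm, ← Matrix.dotProduct_mulVec]

/-- An invertible matrix moves non-zero vectors to non-zero vectors. -/
theorem glm_mulVec_ne_zero (g : GLm p m) {v : Fin m → ZMod p} (hv : v ≠ 0) :
    (g : Mat p m).mulVec v ≠ 0 := by
  intro h
  have h' := congrArg ((g⁻¹ : GLm p m) : Mat p m).mulVec h
  exact hv (by rwa [Matrix.mulVec_mulVec, ← Units.val_mul, inv_mul_cancel, Units.val_one,
    Matrix.one_mulVec, Matrix.mulVec_zero] at h')

/-- **Coset weights kill functions of one vector** (`GL_m`).  If `f` sums to zero over every left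
coset `k · Stab_K(a)` of the stabiliser of `a` in `K`, then `Σ_{k ∈ K} f(k) g(k a) = 0` for every
`g`. -/
theorem sum_weight_mulVec_eq_zero_gl (K : Subgroup (GLm p m)) (f : GLm p m → ℂ)
    (a : Fin m → ZMod p)
    (hf : ∀ k : K, (∑ s : K, if ((s : GLm p m) : Mat p m).mulVec a = a
      then f ((k : GLm p m) * s) else 0) = 0)
    (g : (Fin m → ZMod p) → ℂ) :
    ∑ k : K, f k * g (((k : GLm p m) : Mat p m).mulVec a) = 0 := by
  set S := ∑ k : K, f k * g (((k : GLm p m) : Mat p m).mulVec a) with hS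
  set T := ∑ k : K, ∑ s : K, (if ((s : GLm p m) : Mat p m).mulVec a = a
      then f ((k : GLm p m) * s) * g ((((k * s : K) : GLm p m) : Mat p m).mulVec a) else 0) with hT
  have hT0 : T = 0 := by
    refine Finset.sum_eq_zero fun k _ => ?_
    have hks : ∀ s : K, ((s : GLm p m) : Mat p m).mulVec a = a →
        (((k * s : K) : GLm p m) : Mat p m).mulVec a = ((k : GLm p m) : Mat p m).mulVec a := by
      intro s hs
      rw [Subgroup.coe_mul, Units.val_mul, ← Matrix.mulVec_mulVec, hs]
    calc (∑ s : K, if ((s : GLm p m) : Mat p m).mulVec a = a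
            then f ((k : GLm p m) * s) * g ((((k * s : K) : GLm p m) : Mat p m).mulVec a) else 0)
        = ∑ s : K, (if ((s : GLm p m) : Mat p m).mulVec a = a
            then f ((k : GLm p m) * s) else 0) * g (((k : GLm p m) : Mat p m).mulVec a) := by
          refine Finset.sum_congr rfl fun s _ => ?_
          split_ifs with hs
          · rw [hks s hs]
          · rw [zero_mul]
      _ = 0 := by rw [← Finset.sum_mul, hf k, zero_mul]
  have hTS : T = (∑ s : K, if ((s : GLm p m) : Mat p m).mulVec a = a then (1 : ℂ) else 0) * S := by
    rw [hT, Finset.sum_comm, Finset.sum_mul]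
    refine Finset.sum_congr rfl fun s _ => ?_
    split_ifs with hs
    · rw [one_mul, hS]
      exact Fintype.sum_equiv (Equiv.mulRight s)
        (fun k : K => f ((k : GLm p m) * s) * g ((((k * s : K) : GLm p m) : Mat p m).mulVec a))
        (fun k : K => f k * g (((k : GLm p m) : Mat p m).mulVec a))
        (fun k => by simp only [Equiv.coe_mulRight, Subgroup.coe_mul])
    · simp
  have hN : (∑ s : K, if ((s : GLm p m) : Mat p m).mulVec a = a then (1 : ℂ) else 0) ≠ 0 := by
    rw [Finset.sum_boole, Nat.cast_ne_zero, ← Nat.pos_iff_ne_zero, Finset.card_pos]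
    refine ⟨1, ?_⟩
    simp only [Finset.mem_filter, Finset.mem_univ, true_and, Subgroup.coe_one, Units.val_one,
      Matrix.one_mulVec]
  rw [hTS] at hT0
  exact (mul_eq_zero.mp hT0).resolve_left hN

/-- A coset weight sums to zero over `K` itself (`m ≥ 1`: use any non-zero vector). -/
theorem sum_weight_eq_zero_gl [NeZero m] (K : Subgroup (GLm p m)) (f : GLm p m → ℂ)
    (hf : ∀ a : Fin m → ZMod p, a ≠ 0 → ∀ k : K,
      (∑ s : K, if ((s : GLm p m) : Mat p m).mulVec a = a
        then f ((k : GLm p m) * s) else 0) = 0) :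
    ∑ k : K, f k = 0 := by
  have ha₀ : (Pi.single (0 : Fin m) (1 : ZMod p) : Fin m → ZMod p) ≠ 0 := fun h => by
    simpa using congr_fun h 0
  have h := sum_weight_mulVec_eq_zero_gl K f _ (hf _ ha₀) (fun _ => 1)
  simpa only [mul_one] using h

/-- **Coset weights kill level-one functions** (`GL_m`).  If `f` sums to zero over `K` and over
every left coset of every vector stabiliser `Stab_K(a)`, `a ≠ 0`, then `Σ_{k ∈ K} f(k) F(k) = 0`
for every level-`1` function `F = Σ_{rk M ≤ 1} c_M ψ(tr(M ·))`. -/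
theorem sum_weight_fourier_eq_zero_gl (K : Subgroup (GLm p m)) (f : GLm p m → ℂ)
    (h0 : ∑ k : K, f k = 0)
    (hf : ∀ a : Fin m → ZMod p, a ≠ 0 → ∀ k : K,
      (∑ s : K, if ((s : GLm p m) : Mat p m).mulVec a = a
        then f ((k : GLm p m) * s) else 0) = 0)
    (c : Mat p m → ℂ) (hc : ∀ M : Mat p m, 1 < M.rank → c M = 0) :
    ∑ k : K, f k * ∑ M : Mat p m,
      c M * ZMod.stdAddChar (Matrix.trace (M * ((k : GLm p m) : Mat p m))) = 0 := by
  have hswap : ∑ k : K, f k * ∑ M : Mat p m,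
      c M * ZMod.stdAddChar (Matrix.trace (M * ((k : GLm p m) : Mat p m))) =
      ∑ M : Mat p m, c M * ∑ k : K,
        f k * ZMod.stdAddChar (Matrix.trace (M * ((k : GLm p m) : Mat p m))) := by
    simp_rw [Finset.mul_sum]
    rw [Finset.sum_comm]
    refine Finset.sum_congr rfl fun M _ => Finset.sum_congr rfl fun k _ => ?_
    ring
  rw [hswap]
  refine Finset.sum_eq_zero fun M _ => ?_
  by_cases hcM : c M = 0
  · rw [hcM, zero_mul]
  have hM : M.rank ≤ 1 := by
    by_contra h
    exact hcM (hc M (by omega))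
  obtain ⟨a, b, rfl⟩ := exists_eq_vecMulVec_of_rank_le_one_gl M hM
  simp_rw [trace_vecMulVec_mul_gl]
  by_cases ha : a = 0
  · subst ha
    simp_rw [Matrix.mulVec_zero, dotProduct_zero, AddChar.map_zero_eq_one, mul_one]
    rw [h0, mul_zero]
  · rw [sum_weight_mulVec_eq_zero_gl K f a (hf a ha) (fun w => ZMod.stdAddChar (b ⬝ᵥ w)),
      mul_zero]

/-- **COSET CERTIFICATE ⇒ NO LEVEL-ONE IDENTITY DESIGN** (`GL_m(𝔽_p)`, `m ≥ 1`, all `p`).  `K` a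
subgroup whose non-identity elements are triple products `a b g ∈ H₁ H₂ H₃`, `f(1) ≠ 0`, and `f`
sums to zero over every left coset of every vector stabiliser in `K`.  No TPP, no volume. -/
theorem no_levelOne_design_of_coset_certificate_gl [NeZero m] {H₁ H₂ H₃ : Subgroup (GLm p m)}
    (K : Subgroup (GLm p m)) (f : GLm p m → ℂ) (hf1 : f 1 ≠ 0)
    (hf : ∀ a : Fin m → ZMod p, a ≠ 0 → ∀ k : K,
      (∑ s : K, if ((s : GLm p m) : Mat p m).mulVec a = a
        then f ((k : GLm p m) * s) else 0) = 0)
    (hmem : ∀ k ∈ K, k ≠ 1 → ∃ a ∈ H₁, ∃ b ∈ H₂, ∃ g ∈ H₃, a * b * g = k) :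
    ¬ ∃ c : Mat p m → ℂ, (∀ M, 1 < M.rank → c M = 0) ∧
      (∑ M, c M * ZMod.stdAddChar (Matrix.trace (M * ((1 : GLm p m) : Mat p m)))) = 1 ∧
      ∀ a ∈ H₁, ∀ b ∈ H₂, ∀ g ∈ H₃, a * b * g ≠ 1 →
        (∑ M, c M *
          ZMod.stdAddChar (Matrix.trace (M * ((a * b * g : GLm p m) : Mat p m)))) = 0 := by
  rintro ⟨c, hc, hc1, hc0⟩
  have h0 := sum_weight_fourier_eq_zero_gl K f (sum_weight_eq_zero_gl K f hf) hf c hc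
  rw [Fintype.sum_eq_single (1 : K)] at h0
  · rw [Subgroup.coe_one, hc1, mul_one] at h0
    exact hf1 h0
  · intro k hk
    have hk' : (k : GLm p m) ≠ 1 := fun h => hk (Subtype.ext h)
    obtain ⟨a, ha, b, hb, g, hg, e⟩ := hmem k k.2 hk'
    rw [← e, hc0 a ha b hb g hg (by rw [e]; exact hk'), mul_zero]

omit hp in
/-- `K ≤ H₁` ⇒ every `k ∈ K` is the triple product `k · 1 · 1`. -/
theorem triple_of_le₁ {H₁ H₂ H₃ K : Subgroup (GLm p m)} (hKH : K ≤ H₁) :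
    ∀ k ∈ K, k ≠ 1 → ∃ a ∈ H₁, ∃ b ∈ H₂, ∃ g ∈ H₃, a * b * g = k :=
  fun k hk _ => ⟨k, hKH hk, 1, H₂.one_mem, 1, H₃.one_mem, by rw [mul_one, mul_one]⟩

omit hp in
/-- `K ≤ H₂` ⇒ every `k ∈ K` is the triple product `1 · k · 1`. -/
theorem triple_of_le₂ {H₁ H₂ H₃ K : Subgroup (GLm p m)} (hKH : K ≤ H₂) :
    ∀ k ∈ K, k ≠ 1 → ∃ a ∈ H₁, ∃ b ∈ H₂, ∃ g ∈ H₃, a * b * g = k :=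
  fun k hk _ => ⟨1, H₁.one_mem, k, hKH hk, 1, H₃.one_mem, by rw [one_mul, mul_one]⟩

omit hp in
/-- `K ≤ H₃` ⇒ every `k ∈ K` is the triple product `1 · 1 · k`. -/
theorem triple_of_le₃ {H₁ H₂ H₃ K : Subgroup (GLm p m)} (hKH : K ≤ H₃) :
    ∀ k ∈ K, k ≠ 1 → ∃ a ∈ H₁, ∃ b ∈ H₂, ∃ g ∈ H₃, a * b * g = k :=
  fun k hk _ => ⟨1, H₁.one_mem, 1, H₂.one_mem, k, hKH hk, by rw [one_mul, one_mul]⟩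

omit hp in
/-- **Scalar cover, member `H₁`.**  If the scalar parts cover the centre (`S₁ S₂ S₃ = Z`) and
`H ≤ H₁`, then every product `h z` (`h ∈ H`, `z` scalar) is a triple product `a b g ∈ H₁ H₂ H₃`. -/
theorem triple_of_mul_scalar₁ {H₁ H₂ H₃ : Subgroup (GLm p m)} (H : Subgroup (GLm p m))
    (hHK : H ≤ H₁)
    (hcover : ∀ z ∈ (scalarHom p m).range, ∃ s₁ ∈ H₁ ⊓ (scalarHom p m).range,
      ∃ s₂ ∈ H₂ ⊓ (scalarHom p m).range, ∃ s₃ ∈ H₃ ⊓ (scalarHom p m).range, s₁ * s₂ * s₃ = z) :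
    ∀ h ∈ H, ∀ z ∈ (scalarHom p m).range, ∃ a ∈ H₁, ∃ b ∈ H₂, ∃ g ∈ H₃, a * b * g = h * z := by
  intro h hh z hz
  obtain ⟨s₁, ⟨hs₁, -⟩, s₂, ⟨hs₂, -⟩, s₃, ⟨hs₃, -⟩, hprod⟩ := hcover z hz
  refine ⟨h * s₁, H₁.mul_mem (hHK hh) hs₁, s₂, hs₂, s₃, hs₃, ?_⟩
  rw [← hprod]
  simp only [mul_assoc]

/-- **Scalar cover, member `H₂`** (scalars are central). -/
theorem triple_of_mul_scalar₂ {H₁ H₂ H₃ : Subgroup (GLm p m)} (H : Subgroup (GLm p m))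
    (hHK : H ≤ H₂)
    (hcover : ∀ z ∈ (scalarHom p m).range, ∃ s₁ ∈ H₁ ⊓ (scalarHom p m).range,
      ∃ s₂ ∈ H₂ ⊓ (scalarHom p m).range, ∃ s₃ ∈ H₃ ⊓ (scalarHom p m).range, s₁ * s₂ * s₃ = z) :
    ∀ h ∈ H, ∀ z ∈ (scalarHom p m).range, ∃ a ∈ H₁, ∃ b ∈ H₂, ∃ g ∈ H₃, a * b * g = h * z := by
  intro h hh z hz
  obtain ⟨s₁, ⟨hs₁, ⟨v, rfl⟩⟩, s₂, ⟨hs₂, -⟩, s₃, ⟨hs₃, -⟩, hprod⟩ := hcover z hz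
  refine ⟨scalarHom p m v, hs₁, h * s₂, H₂.mul_mem (hHK hh) hs₂, s₃, hs₃, ?_⟩
  rw [← hprod, ← mul_assoc, ← mul_assoc, scalarHom_comm v h]
  simp only [mul_assoc]

/-- **Scalar cover, member `H₃`** (scalars are central). -/
theorem triple_of_mul_scalar₃ {H₁ H₂ H₃ : Subgroup (GLm p m)} (H : Subgroup (GLm p m))
    (hHK : H ≤ H₃)
    (hcover : ∀ z ∈ (scalarHom p m).range, ∃ s₁ ∈ H₁ ⊓ (scalarHom p m).range,
      ∃ s₂ ∈ H₂ ⊓ (scalarHom p m).range, ∃ s₃ ∈ H₃ ⊓ (scalarHom p m).range, s₁ * s₂ * s₃ = z) :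
    ∀ h ∈ H, ∀ z ∈ (scalarHom p m).range, ∃ a ∈ H₁, ∃ b ∈ H₂, ∃ g ∈ H₃, a * b * g = h * z := by
  intro h hh z hz
  obtain ⟨s₁, ⟨hs₁, ⟨v₁, rfl⟩⟩, s₂, ⟨hs₂, ⟨v₂, rfl⟩⟩, s₃, ⟨hs₃, -⟩, hprod⟩ := hcover z hz
  refine ⟨scalarHom p m v₁, hs₁, scalarHom p m v₂, hs₂, h * s₃, H₃.mul_mem (hHK hh) hs₃, ?_⟩
  rw [← hprod, ← map_mul, ← mul_assoc, ← mul_assoc, scalarHom_comm (v₁ * v₂) h]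

/-- A multiplicative weight summing to zero over every vector stabiliser is a coset certificate. -/
theorem coset_weight_of_character_gl (K : Subgroup (GLm p m)) (χ : GLm p m → ℂ)
    (hmul : ∀ k ∈ K, ∀ s ∈ K, χ (k * s) = χ k * χ s)
    (hstab : ∀ a : Fin m → ZMod p, a ≠ 0 →
      (∑ s : K, if ((s : GLm p m) : Mat p m).mulVec a = a then χ s else 0) = 0) :
    ∀ a : Fin m → ZMod p, a ≠ 0 → ∀ k : K,
      (∑ s : K, if ((s : GLm p m) : Mat p m).mulVec a = a
        then χ ((k : GLm p m) * s) else 0) = 0 := by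
  intro a ha k
  calc (∑ s : K, if ((s : GLm p m) : Mat p m).mulVec a = a then χ ((k : GLm p m) * s) else 0)
      = ∑ s : K, χ k * (if ((s : GLm p m) : Mat p m).mulVec a = a then χ s else 0) := by
        refine Finset.sum_congr rfl fun s _ => ?_
        split_ifs
        · exact hmul k k.2 s s.2
        · rw [mul_zero]
    _ = 0 := by rw [← Finset.mul_sum, hstab a ha, mul_zero]

/-- **CHARACTER CERTIFICATE** (`GL_m(𝔽_p)`, `m ≥ 1`, all `p`).  `K ∖ 1 ⊆ H₁ H₂ H₃` as triple
products, `χ` multiplicative on `K` with `χ 1 ≠ 0` and `Σ_{s ∈ K, s a = a} χ(s) = 0` for every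
`a ≠ 0` (i.e. `χ` non-trivial on every vector stabiliser) ⇒ no level-one identity design. -/
theorem no_levelOne_design_of_character_gl [NeZero m] {H₁ H₂ H₃ : Subgroup (GLm p m)}
    (K : Subgroup (GLm p m)) (χ : GLm p m → ℂ) (hχ1 : χ 1 ≠ 0)
    (hmul : ∀ k ∈ K, ∀ s ∈ K, χ (k * s) = χ k * χ s)
    (hstab : ∀ a : Fin m → ZMod p, a ≠ 0 →
      (∑ s : K, if ((s : GLm p m) : Mat p m).mulVec a = a then χ s else 0) = 0)
    (hmem : ∀ k ∈ K, k ≠ 1 → ∃ a ∈ H₁, ∃ b ∈ H₂, ∃ g ∈ H₃, a * b * g = k) :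
    ¬ ∃ c : Mat p m → ℂ, (∀ M, 1 < M.rank → c M = 0) ∧
      (∑ M, c M * ZMod.stdAddChar (Matrix.trace (M * ((1 : GLm p m) : Mat p m)))) = 1 ∧
      ∀ a ∈ H₁, ∀ b ∈ H₂, ∀ g ∈ H₃, a * b * g ≠ 1 →
        (∑ M, c M *
          ZMod.stdAddChar (Matrix.trace (M * ((a * b * g : GLm p m) : Mat p m)))) = 0 :=
  no_levelOne_design_of_coset_certificate_gl K χ hχ1 (coset_weight_of_character_gl K χ hmul hstab)
    hmem

/-- **A faithful determinant character on `GL_m(𝔽_p)`**: a multiplicative `η : GL_m(𝔽_p) → ℂ`,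
`η 1 = 1`, with kernel exactly `SL_m(𝔽_p)` (`η = ψ ∘ e⁻¹ ∘ det`, `e : ℤ/(p-1) ≃ 𝔽_pˣ`). -/
theorem exists_faithful_detChar_gl :
    ∃ η : GLm p m → ℂ, η 1 = 1 ∧ (∀ k k' : GLm p m, η (k * k') = η k * η k') ∧
      ∀ k : GLm p m, η k = 1 → Matrix.det (k : Mat p m) = 1 := by
  haveI : NeZero (Nat.card (ZMod p)ˣ) := ⟨(Nat.card_pos (α := (ZMod p)ˣ)).ne'⟩
  set e : Multiplicative (ZMod (Nat.card (ZMod p)ˣ)) ≃* (ZMod p)ˣ :=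
    zmodCyclicMulEquiv (G := (ZMod p)ˣ) inferInstance with he
  refine ⟨fun k => ZMod.stdAddChar
      (Multiplicative.toAdd (e.symm (Matrix.GeneralLinearGroup.det k))), ?_, ?_, ?_⟩
  · simp only [map_one]
    rw [toAdd_one, AddChar.map_zero_eq_one]
  · intro k k'
    simp only [map_mul, toAdd_mul, AddChar.map_add_eq_mul]
  · intro k hk
    have h0 : Multiplicative.toAdd (e.symm (Matrix.GeneralLinearGroup.det k)) = 0 :=
      ZMod.injective_stdAddChar (by rw [AddChar.map_zero_eq_one]; exact hk)
    have h1 : e.symm (Matrix.GeneralLinearGroup.det k) = 1 := by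
      rw [← ofAdd_toAdd (e.symm _), h0]
      rfl
    have h2 : Matrix.GeneralLinearGroup.det k = 1 := by
      simpa only [MulEquiv.apply_symm_apply, map_one] using congrArg e h1
    simpa [Matrix.GeneralLinearGroup.val_det_apply] using
      congrArg (fun u : (ZMod p)ˣ => (u : ZMod p)) h2

omit hp in
/-- The stabiliser of a vector inside `K`, as a subgroup of `GL_m(𝔽_p)`. -/
theorem exists_stab_subgroup_gl (K : Subgroup (GLm p m)) (a : Fin m → ZMod p) :
    ∃ S : Subgroup (GLm p m), ∀ s : GLm p m,
      s ∈ S ↔ s ∈ K ∧ ((s : GLm p m) : Mat p m).mulVec a = a := by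
  refine ⟨{ carrier := {s | s ∈ K ∧ ((s : GLm p m) : Mat p m).mulVec a = a},
            one_mem' := ⟨K.one_mem, by simp⟩,
            mul_mem' := ?_, inv_mem' := ?_ }, fun s => Iff.rfl⟩
  · rintro s t ⟨hs, hsa⟩ ⟨ht, hta⟩
    refine ⟨K.mul_mem hs ht, ?_⟩
    rw [Units.val_mul, ← Matrix.mulVec_mulVec, hta, hsa]
  · rintro s ⟨hs, hsa⟩
    refine ⟨K.inv_mem hs, ?_⟩
    have h := congrArg (((s⁻¹ : GLm p m) : Mat p m).mulVec) hsa
    rw [Matrix.mulVec_mulVec, ← Units.val_mul, inv_mul_cancel, Units.val_one,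
      Matrix.one_mulVec] at h
    exact h.symm

/-- **Stabiliser sums of the faithful determinant character vanish at a det-fixed vector.**  If
`a` is fixed by some `s₀ ∈ K` with `det s₀ ≠ 1`, then `Σ_{s ∈ K, s a = a} η(s) = 0` for every
multiplicative `η` with kernel `SL_m`. -/
theorem sum_stab_detChar_eq_zero_gl (K : Subgroup (GLm p m))
    (η : GLm p m → ℂ) (hη1 : η 1 = 1) (hmul : ∀ k k' : GLm p m, η (k * k') = η k * η k')
    (hfaith : ∀ k : GLm p m, η k = 1 → Matrix.det (k : Mat p m) = 1)
    (a : Fin m → ZMod p)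
    (hfix : ∃ s ∈ K, Matrix.det ((s : GLm p m) : Mat p m) ≠ 1 ∧
      ((s : GLm p m) : Mat p m).mulVec a = a) :
    (∑ s : K, if ((s : GLm p m) : Mat p m).mulVec a = a then η s else 0) = 0 := by
  obtain ⟨S, hS⟩ := exists_stab_subgroup_gl K a
  let φ : S →* ℂ :=
    { toFun := fun s => η s
      map_one' := by rw [Subgroup.coe_one, hη1]
      map_mul' := fun s t => by rw [Subgroup.coe_mul, hmul] }
  have hφ : φ ≠ 1 := by
    obtain ⟨s₀, hs₀K, hs₀d, hs₀a⟩ := hfix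
    intro h1
    have hη : η s₀ = 1 := by
      have := DFunLike.congr_fun h1 ⟨s₀, (hS s₀).2 ⟨hs₀K, hs₀a⟩⟩
      simpa [φ] using this
    exact hs₀d (hfaith s₀ hη)
  have hsum := sum_hom_units_eq_zero φ hφ
  have hL : (∑ s : K, if ((s : GLm p m) : Mat p m).mulVec a = a then η s else 0) =
      ∑ x ∈ (Finset.univ.filter fun x : GLm p m => x ∈ K),
        if (x : Mat p m).mulVec a = a then η x else 0 :=
    (Finset.sum_subtype (Finset.univ.filter fun x : GLm p m => x ∈ K) (by simp)
      (fun x : GLm p m => if (x : Mat p m).mulVec a = a then η x else 0)).symm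
  have hR : (∑ s : S, φ s) = ∑ x ∈ (Finset.univ.filter fun x : GLm p m => x ∈ S), η x :=
    (Finset.sum_subtype (Finset.univ.filter fun x : GLm p m => x ∈ S) (by simp)
      (fun x : GLm p m => η x)).symm
  rw [hL, ← Finset.sum_filter]
  convert hR ▸ hsum using 2
  ext x
  simp only [Finset.mem_filter, Finset.mem_univ, true_and, hS x]

/-- **DET-FIXERS ⇒ NO LEVEL-ONE IDENTITY DESIGN** (`GL_m(𝔽_p)`, `m ≥ 1`, all `p`).  `K ∖ 1 ⊆
H₁ H₂ H₃` as triple products and every non-zero vector fixed by some `s ∈ K` with `det s ≠ 1` ⇒ no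
design.  No TPP, no volume, no `p`-freeness. -/
theorem no_levelOne_design_of_detFixers_gl [NeZero m] {H₁ H₂ H₃ : Subgroup (GLm p m)}
    (K : Subgroup (GLm p m))
    (hmem : ∀ k ∈ K, k ≠ 1 → ∃ a ∈ H₁, ∃ b ∈ H₂, ∃ g ∈ H₃, a * b * g = k)
    (hfix : ∀ a : Fin m → ZMod p, a ≠ 0 →
      ∃ s ∈ K, Matrix.det ((s : GLm p m) : Mat p m) ≠ 1 ∧ ((s : GLm p m) : Mat p m).mulVec a = a) :
    ¬ ∃ c : Mat p m → ℂ, (∀ M, 1 < M.rank → c M = 0) ∧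
      (∑ M, c M * ZMod.stdAddChar (Matrix.trace (M * ((1 : GLm p m) : Mat p m)))) = 1 ∧
      ∀ a ∈ H₁, ∀ b ∈ H₂, ∀ g ∈ H₃, a * b * g ≠ 1 →
        (∑ M, c M *
          ZMod.stdAddChar (Matrix.trace (M * ((a * b * g : GLm p m) : Mat p m)))) = 0 := by
  obtain ⟨η, hη1, hmul, hfaith⟩ := exists_faithful_detChar_gl (p := p) (m := m)
  exact no_levelOne_design_of_character_gl K η (by rw [hη1]; exact one_ne_zero)
    (fun k _ s _ => hmul k s)
    (fun a _ => sum_stab_detChar_eq_zero_gl K η hη1 hmul hfaith a (hfix a ‹_›)) hmem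

/-- **Pigeonhole fixers** (`GL_m`).  A subgroup `K ≤ GL_m(𝔽_p)` with more than `p^m - 1` elements
fixes every non-zero vector non-trivially: `k ↦ k a` maps `K` into the `p^m - 1` non-zero vectors,
so two distinct `k ≠ k'` agree at `a` and `k'⁻¹ k ∈ Stab_K(a) ∖ 1`. -/
theorem exists_fixer_of_card_gt_gl (K : Subgroup (GLm p m)) (hbig : p ^ m - 1 < Nat.card K)
    (a : Fin m → ZMod p) (ha : a ≠ 0) :
    ∃ s ∈ K, s ≠ 1 ∧ ((s : GLm p m) : Mat p m).mulVec a = a := by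
  let φ : K → {v : Fin m → ZMod p // v ≠ 0} :=
    fun k => ⟨((k : GLm p m) : Mat p m).mulVec a, glm_mulVec_ne_zero _ ha⟩
  have hcard : Fintype.card {v : Fin m → ZMod p // v ≠ 0} < Fintype.card K := by
    have h1 : Fintype.card {v : Fin m → ZMod p // v ≠ 0} < Fintype.card (Fin m → ZMod p) :=
      Fintype.card_subtype_lt (p := fun v : Fin m → ZMod p => v ≠ 0) (x := 0) (by simp)
    have h2 : Fintype.card (Fin m → ZMod p) = p ^ m := by
      rw [Fintype.card_fun, ZMod.card, Fintype.card_fin]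
    rw [← Nat.card_eq_fintype_card (α := K)]
    omega
  obtain ⟨k, k', hne, hkk'⟩ := Fintype.exists_ne_map_eq_of_card_lt φ hcard
  have hv : ((k : GLm p m) : Mat p m).mulVec a = ((k' : GLm p m) : Mat p m).mulVec a :=
    congrArg Subtype.val hkk'
  refine ⟨((k'⁻¹ * k : K) : GLm p m), (k'⁻¹ * k).2, ?_, ?_⟩
  · intro h
    have h' : k'⁻¹ * k = 1 := Subtype.ext (by rw [h, Subgroup.coe_one])
    exact hne (inv_mul_eq_one.mp h').symm
  · rw [Subgroup.coe_mul, Subgroup.coe_inv, Units.val_mul, ← Matrix.mulVec_mulVec, hv,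
      Matrix.mulVec_mulVec, ← Units.val_mul, inv_mul_cancel, Units.val_one, Matrix.one_mulVec]

end GLmLevelOneCertificates

end Summit.MatrixMultiplication.MatrixMultiplication.Theorems.SubgroupIdentityDesigns.Negative
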